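import Summits.ResolutionOfSingularities.ResolutionOfSingularities.Theorems.EquisingularLiftEquisingularLiftNatNDRoundModelSplit
import HarnessLib

/-!
# [OURS · L1 W4.5(b) · EL♮(3)] ND INVARIANTS, POINTWISE VARIANT — `…NatNDInvariantsP` (desk R36 (α) «(K-reg) = (i) LOCALISE, strong form L0» + R36′ (1) suffix `P`;
# WIDTH TABLE D2 hand (L-1) = the PORT; INVARIANT FREEZE 2)

OURS · L1 W4.5(b) · EL♮(3) stmt-ResolutionOfSingularities-20148 (parent EL♮ stmt-…-20038) · counted 0 · AI-written (res-L1-w45b-idea-1 g23 SPEC K6 §P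
`Cruxes/EquisingularLiftNatThree/NDLeavesRungK6Loc.lean` sha16 f77b6557f71afa0f — the `…P` declarations VERBATIM; ported to the tree by the text owner res-L1-w45b-lead-2 g7),
weaker than expert review; nothing of [Hironaka2017] asserted; no statement of the manuscript.  Definitions + PROVED pure plumbing only (no `sorry`, no instance, no
notation; standard axioms).  CONTENT: the downstairs ND invariant of ✓ p639684 / ✓ p643982 WITHOUT its global clause `Scheme.IsRegular F` — `ND.NDInvP` (= `ND.NDInv`
minus conjunct 1), `ND.NDInvCP` (+ `IsClosed T`), `ND.NDInvCLNP` (+ `IsLocallyNoetherian F`), the projection `ND.ndInvCLNP_of_ndInvCLN`, the END at measure 0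
`ND.ndInvCLNP_end` (proof of `ndInv_end` verbatim — clause 1 was never used).  WHY (three concordant audits,
desk R36 (α)): the ambient regularity is consumed only pointwise at the round point (supplied by the frame data, `ND.IsNDFrameAt` = an r.s.p.), re-emitted only to
feed itself, and discarded by `ndInv_end`; the A⁗-prefix customers of the ND-LEAVES programme (R33 (β)) end at k-stages that are NOT globally regular.  RULE (desk):
NEW FILES ONLY — the landed chain (✓ p639684 … ✓ p647090, the 35th) stays untouched; every D2 brick ((L-R0)/(L-β0)/(L-β1)/(L-β2)/(L-δ)/(L-ℓ)/(L-Ω)) is stated BY NAME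
against THESE declarations (namespace `…Sections.ND`, names = the spec's).  `--supports stmt-ResolutionOfSingularities-20148 --as helper`.
-/

set_option linter.dupNamespace false
set_option linter.overlappingInstances false -- K5′-style signatures carry `[IsDomain O] [IsDiscreteValuationRing O]`

noncomputable section

open CategoryTheory CategoryTheory.Limits AlgebraicGeometry TopologicalSpace Topology IsLocalRing
open MvPolynomial
open Literature.AlgebraicGeometry.Resolution
open AlgebraicGeometry.Scheme.IdealSheafData

namespace Summit.ResolutionOfSingularities.ResolutionOfSingularities.Cruxes.EquisingularLiftNat.Sections.ND

open Summit.ResolutionOfSingularities.ResolutionOfSingularities.Cruxes.EquisingularLiftNat.Sections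

/-- **`ND.NDInvP n k m F ρ T`** — the ND invariant WITHOUT its global clause: = ✓ p639684 `ND.NDInv` minus `Scheme.IsRegular F ∧` (clauses 2–3 VERBATIM: the
non-regular points of the reduced closure of `T` are exactly a finite set `S` of `m` points, each closed with local ND frame data — `ND.IsNDFrameAt` makes
`𝒪_{F,x}` regular AT those points, which is all `ND.RoundFacts` asks). [OURS · L1 W4.5b · candidate invariant of the localised chain] -/
def NDInvP (n : ℕ) (k : Type) [Field k] (m : ℕ) (F : AlgebraicGeometry.Scheme.{0}) (ρ : F ⟶ (Literature.AlgebraicGeometry.Motives.projectiveSpace n k).left) (T : Set F) : Prop :=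
  ∃ S : Finset F, S.card = m ∧
    (∀ z : ↥(AlgebraicGeometry.Scheme.IdealSheafData.vanishingIdeal (⟨closure T, isClosed_closure⟩ : TopologicalSpace.Closeds F)).subscheme, IsRegularLocalRing ((AlgebraicGeometry.Scheme.IdealSheafData.vanishingIdeal (⟨closure T, isClosed_closure⟩ : TopologicalSpace.Closeds F)).subscheme.presheaf.stalk z) ↔ ((AlgebraicGeometry.Scheme.IdealSheafData.vanishingIdeal (⟨closure T, isClosed_closure⟩ : TopologicalSpace.Closeds F)).subschemeι z : F) ∉ S) ∧
    (∀ x ∈ S, (∃ z : ↥(AlgebraicGeometry.Scheme.IdealSheafData.vanishingIdeal (⟨closure T, isClosed_closure⟩ : TopologicalSpace.Closeds F)).subscheme, ((AlgebraicGeometry.Scheme.IdealSheafData.vanishingIdeal (⟨closure T, isClosed_closure⟩ : TopologicalSpace.Closeds F)).subschemeι z : F) = x) ∧ IsClosed ({x} : Set F) ∧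
      ∃ W : Fin n → F.IdealSheafData, IsNDFrameAt n k ρ T W x)

/-- `NDInvCP` := `NDInvP ∧ IsClosed T` (as `NDInvC`). [OURS] -/
def NDInvCP (n : ℕ) (k : Type) [Field k] (m : ℕ) (F : AlgebraicGeometry.Scheme.{0}) (ρ : F ⟶ (Literature.AlgebraicGeometry.Motives.projectiveSpace n k).left) (T : Set F) : Prop :=
  NDInvP n k m F ρ T ∧ IsClosed T

/-- `NDInvCLNP` := `NDInvCP ∧ IsLocallyNoetherian F` (as the port's `NDInvCLN`; local Noetherianity is KEPT: it is true and certifiable for every prefix end —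
blow-ups of finite-type `k`-schemes — unlike regularity). [OURS] -/
def NDInvCLNP (n : ℕ) (k : Type) [Field k] (m : ℕ) (F : AlgebraicGeometry.Scheme.{0}) (ρ : F ⟶ (Literature.AlgebraicGeometry.Motives.projectiveSpace n k).left) (T : Set F) : Prop :=
  NDInvCP n k m F ρ T ∧ IsLocallyNoetherian F

/-- The port's invariant implies the pointwise one (drop clause 1). [OURS · pure logic] -/
theorem ndInvCLNP_of_ndInvCLN (n : ℕ) (k : Type) [Field k] {m : ℕ} {F : AlgebraicGeometry.Scheme.{0}} {ρ : F ⟶ (Literature.AlgebraicGeometry.Motives.projectiveSpace n k).left} {T : Set F}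
    (h : NDInvCLN n k m F ρ T) : NDInvCLNP n k m F ρ T :=
  ⟨⟨h.1.1.2, h.1.2⟩, h.2⟩

/-- (B4-end) for `NDInvCLNP`: at measure `0` the reduced closure is regular (proof of ✓ `ndInv_end` VERBATIM — clause 1 was never used). [OURS · PROVED] -/
theorem ndInvCLNP_end (n : ℕ) (k : Type) [Field k] (F : AlgebraicGeometry.Scheme.{0}) (ρ : F ⟶ (Literature.AlgebraicGeometry.Motives.projectiveSpace n k).left) (T : Set F) (h : NDInvCLNP n k 0 F ρ T) :
    Literature.AlgebraicGeometry.Resolution.Scheme.IsRegular (AlgebraicGeometry.Scheme.IdealSheafData.vanishingIdeal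
      (⟨closure T, isClosed_closure⟩ : TopologicalSpace.Closeds F)).subscheme := by
  obtain ⟨⟨⟨S, hS, hreg, -⟩, -⟩, -⟩ := h
  have hS' : S = ∅ := Finset.card_eq_zero.mp hS
  intro z
  exact (hreg z).mpr (by simp [hS'])

end Summit.ResolutionOfSingularities.ResolutionOfSingularities.Cruxes.EquisingularLiftNat.Sections.ND

end
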